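import Literature.Probability.Percolation.ArmSeparationTubes
import Literature.Probability.Percolation.ArmEventsAPriori
import HarnessLib

/-!
# Ring roads: chains of tubes around a hexagon of `𝕋`

Topic: Probability / Percolation; family `crit-perc`. A toolkit brick of the discharge of
`Literature.Probability.Percolation.Nolin2008_twoArm_separation` (Nolin 2008, Thm. 11
[arXiv 0711.4948: Thm. 10]; `ArmSeparation.lean`), landing step of the internal extremities
(Nolin 2008, Prop. 12 (iii)–(i) [arXiv Prop. 11]: RSW corridors). The corridors that carry a
fenced inner tip from its side of `∂Λ_m` to the prescribed landing side travel along a **ring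
road**: a closed chain of tubes (`ArmSeparationTubes.lean`) following the hexagon
`|v|_𝕋 = r` — one tube along each of the four sides parallel to a coordinate axis
(`x₀ = ±r`, `x₁ = ±r`) and a staircase of `2 (r/s)` tubes of step `s` along each of the two
diagonal sides (`x₀ + x₁ = ±r`), consecutive tubes crossing like a plus sign, all sites having
norm in `[r - s - 2e, r + 2e]` (`e` the half-width of the tubes).

* `Tube.neg` — the centrally symmetric tube; `Crosses`, aspect ratio under `neg`;
* `stairH r e s j`, `stairV r e s j` — the `j`-th horizontal / vertical step of the staircase
  along `x₀ + x₁ = r` from `(r, 0)` to `(0, r)`; `stair r e s j₁ j₂` — the steps `j₁ ≤ j < j₂`;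
  `isChain_stair`, norms (`triNorm_mem_of_mem_stair`), aspect ratios;
* `side0 r e`, `side2 r e` (and their reflections: sides `x₀ = -r`, `x₁ = -r`) — the straight sides;
* the vertex junctions and `halfRing r e s` (sides `x₀ = r`, `x₀ + x₁ = r`, `x₁ = r`) with
  `isChain_halfRing`; `ring r e s = halfRing ++ halfRing.map neg` with `isChain_ring` and
  `crosses_ring_close` (the last tube crosses the first: the chain closes up).

## References

* P. Nolin, *Near-critical percolation in two dimensions*, Electron. J. Probab. 13 (2008), §4.3,
  Prop. 12 (proof) [arXiv 0711.4948: Prop. 11]. [Nolin2008]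
* H. Kesten, *Scaling relations for 2D-percolation*, Comm. Math. Phys. 109 (1987), Lemma 2. [Kesten1987]
* G. Grimmett, *Percolation*, 2nd ed. (1999), §11.7 (RSW chaining). [GrimmettPercolation1999]
-/

noncomputable section

open Set

namespace Literature.Probability.Percolation

open LatticeModels

namespace Tube

/-! ### Central symmetry -/

/-- The centrally symmetric tube `-T` (same dimensions and direction). [folklore] -/
def neg (T : Tube) : Tube := ⟨-T.a - T.w, -T.b - T.h, T.w, T.h, T.horiz⟩

/-- Fields of `-T`. [folklore] -/
@[simp] theorem neg_a (T : Tube) : T.neg.a = -T.a - T.w := rfl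
/-- Fields of `-T`. [folklore] -/
@[simp] theorem neg_b (T : Tube) : T.neg.b = -T.b - T.h := rfl
/-- Fields of `-T`. [folklore] -/
@[simp] theorem neg_w (T : Tube) : T.neg.w = T.w := rfl
/-- Fields of `-T`. [folklore] -/
@[simp] theorem neg_h (T : Tube) : T.neg.h = T.h := rfl
/-- Fields of `-T`. [folklore] -/
@[simp] theorem neg_horiz (T : Tube) : T.neg.horiz = T.horiz := rfl

/-- The box of `-T` is the reflected box. [folklore] -/
theorem mem_box_neg {T : Tube} {v : Site 2} : v ∈ T.neg.box ↔ -v ∈ T.box := by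
  rw [Tube.mem_box, Tube.mem_box]
  simp only [neg_a, neg_b, neg_w, neg_h, Pi.neg_apply]
  omega

/-- `Crosses` is invariant under the central symmetry. [folklore] -/
theorem crosses_neg {T T' : Tube} (h : Crosses T T') : Crosses T.neg T'.neg := by
  rcases h with ⟨h1, h2, h3, h4, h5, h6⟩ | ⟨h1, h2, h3, h4, h5, h6⟩
  · refine Or.inl ⟨h1, h2, ?_, ?_, ?_, ?_⟩ <;> simp only [neg_a, neg_b, neg_w, neg_h] <;> omega
  · refine Or.inr ⟨h1, h2, ?_, ?_, ?_, ?_⟩ <;> simp only [neg_a, neg_b, neg_w, neg_h] <;> omega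

/-- Aspect ratios are invariant under the central symmetry. [folklore] -/
theorem aspectLE_neg {T : Tube} {ρ : ℕ} (h : T.AspectLE ρ) : T.neg.AspectLE ρ := by
  unfold AspectLE at h ⊢; simpa only [neg_w, neg_h, neg_horiz] using h

/-- A chain of crossing tubes stays one under the central symmetry. [folklore] -/
theorem isChain_map_neg {L : List Tube} (h : List.IsChain Crosses L) : List.IsChain Crosses (L.map neg) :=
  List.isChain_map_of_isChain neg (fun _ _ hab => crosses_neg hab) h

end Tube

open Tube

/-! ### The staircase along `x₀ + x₁ = r` -/

/-- The `j`-th horizontal step: from `(r - js, js)` left to `(r - (j+1)s, js)`, i.e. the tube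
`[r - (j+1)s - e, r - js + e] × [js - e, js + e]` crossed horizontally. [folklore] -/
def stairH (r e s j : ℕ) : Tube := ⟨(r : ℤ) - (j + 1) * s - e, (j : ℤ) * s - e, s + 2 * e, 2 * e, true⟩

/-- The `j`-th vertical step: from `(r - (j+1)s, js)` up to `(r - (j+1)s, (j+1)s)`, i.e. the tube
`[r - (j+1)s - e, r - (j+1)s + e] × [js - e, (j+1)s + e]` crossed vertically. [folklore] -/
def stairV (r e s j : ℕ) : Tube := ⟨(r : ℤ) - (j + 1) * s - e, (j : ℤ) * s - e, 2 * e, s + 2 * e, false⟩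

/-- The steps `j₁ ≤ j < j₁ + d` of the staircase, in order: `H_{j₁}, V_{j₁}, H_{j₁+1}, V_{j₁+1}, …`. [folklore] -/
def stair (r e s : ℕ) : ℕ → ℕ → List Tube
  | _, 0 => []
  | j₁, d + 1 => stairH r e s j₁ :: stairV r e s j₁ :: stair r e s (j₁ + 1) d

/-- `H_j` crosses `V_j`. [folklore] -/
theorem crosses_stairH_stairV (r e s j : ℕ) : Crosses (stairH r e s j) (stairV r e s j) := by
  refine Or.inl ⟨rfl, rfl, ?_, ?_, ?_, ?_⟩ <;> simp only [stairH, stairV] <;> push_cast <;> nlinarith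

/-- `V_j` crosses `H_{j+1}`. [folklore] -/
theorem crosses_stairV_stairH (r e s j : ℕ) : Crosses (stairV r e s j) (stairH r e s (j + 1)) := by
  refine Or.inr ⟨rfl, rfl, ?_, ?_, ?_, ?_⟩ <;> simp only [stairH, stairV] <;> push_cast <;> nlinarith

/-- The head of a nonempty staircase. [folklore] -/
theorem head?_stair (r e s j₁ d : ℕ) : (stair r e s j₁ (d + 1)).head? = some (stairH r e s j₁) := rfl

/-- Adding a step at the end: `stair j₁ (d+1) = stair j₁ d ++ [H_{j₁+d}, V_{j₁+d}]`. [folklore] -/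
theorem stair_succ (r e s : ℕ) : ∀ j₁ d : ℕ, stair r e s j₁ (d + 1) = stair r e s j₁ d ++ [stairH r e s (j₁ + d), stairV r e s (j₁ + d)]
  | j₁, 0 => by simp [stair]
  | j₁, d + 1 => by
    rw [stair, stair_succ r e s (j₁ + 1) d, stair]
    simp [Nat.add_assoc, Nat.add_comm 1 d]

/-- The last tube of a nonempty staircase is its last vertical step. [folklore] -/
theorem getLast?_stair (r e s j₁ d : ℕ) : (stair r e s j₁ (d + 1)).getLast? = some (stairV r e s (j₁ + d)) := by
  rw [stair_succ, List.getLast?_append]; simp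

/-- The staircase is a chain of crossing tubes. [folklore] -/
theorem isChain_stair (r e s : ℕ) : ∀ j₁ d : ℕ, List.IsChain Crosses (stair r e s j₁ d)
  | _, 0 => List.isChain_nil
  | j₁, d + 1 => by
    rw [stair]
    refine List.IsChain.cons_cons (crosses_stairH_stairV r e s j₁) (List.IsChain.cons (isChain_stair r e s (j₁ + 1) d) fun y hy => ?_)
    cases d with
    | zero => simp [stair] at hy
    | succ d =>
      rw [head?_stair] at hy
      simp only [Option.mem_def, Option.some.injEq] at hy
      rw [← hy]; exact crosses_stairV_stairH r e s j₁

/-- Membership in the staircase: a tube of `stair j₁ d` is some `H_j` or `V_j`, `j₁ ≤ j < j₁ + d`. [folklore] -/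
theorem mem_stair {r e s : ℕ} : ∀ {j₁ d : ℕ} {T : Tube}, T ∈ stair r e s j₁ d →
    ∃ j, j₁ ≤ j ∧ j < j₁ + d ∧ (T = stairH r e s j ∨ T = stairV r e s j)
  | _, 0, _, hT => by simp [stair] at hT
  | j₁, d + 1, T, hT => by
    rw [stair] at hT
    simp only [List.mem_cons] at hT
    rcases hT with rfl | rfl | hT
    · exact ⟨j₁, le_rfl, by omega, Or.inl rfl⟩
    · exact ⟨j₁, le_rfl, by omega, Or.inr rfl⟩
    · obtain ⟨j, hj1, hj2, hj⟩ := mem_stair hT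
      exact ⟨j, by omega, by omega, hj⟩

/-- The steps have aspect ratio at most `ρ` when `s + 2e ≤ 2ρ e` and `1 ≤ e`. [folklore] -/
theorem aspectLE_of_mem_stair {r e s j₁ d ρ : ℕ} (he : 1 ≤ e) (hρ : s + 2 * e ≤ ρ * (2 * e)) {T : Tube}
    (hT : T ∈ stair r e s j₁ d) : T.AspectLE ρ := by
  obtain ⟨j, -, -, rfl | rfl⟩ := mem_stair hT
  · simp only [AspectLE, stairH, cond_true]; omega
  · simp only [AspectLE, stairV, cond_false]; omega

/-- **The staircase hugs the diagonal**: every site of a tube of `stair r e s j₁ d`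
(`(j₁ + d) s ≤ r`) has norm in `[r - s - 2e, r + 2e]` and lies in the quadrant
`{x₀ ≥ -e, x₁ ≥ -e}`. [folklore] -/
theorem triNorm_mem_of_mem_stair {r e s j₁ d : ℕ} (hj : (j₁ + d) * s ≤ r) {T : Tube} (hT : T ∈ stair r e s j₁ d)
    {v : Site 2} (hv : v ∈ T.box) : (r : ℤ) - s - 2 * e ≤ triNorm v ∧ triNorm v ≤ (r : ℤ) + 2 * e ∧ -(e : ℤ) ≤ v 0 ∧ -(e : ℤ) ≤ v 1 := by
  obtain ⟨j, -, hj2, hT⟩ := mem_stair hT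
  have h1 : ((j : ℤ) + 1) * s ≤ r := by
    have : (j + 1) * s ≤ (j₁ + d) * s := Nat.mul_le_mul_right _ hj2
    have : (((j + 1) * s : ℕ) : ℤ) ≤ (r : ℤ) := by exact_mod_cast this.trans hj
    push_cast at this; linarith
  have h2 : (0 : ℤ) ≤ (j : ℤ) * s := by positivity
  rcases hT with rfl | rfl
  · rw [Tube.mem_box] at hv
    simp only [stairH] at hv
    push_cast at hv
    refine ⟨le_triNorm_iff_lin.2 ?_, triNorm_le_iff_lin.2 ?_, by nlinarith, by nlinarith⟩
    · right; right; right; right; left; nlinarith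
    · refine ⟨by nlinarith, by nlinarith, by nlinarith, by nlinarith, by nlinarith, by nlinarith⟩
  · rw [Tube.mem_box] at hv
    simp only [stairV] at hv
    push_cast at hv
    refine ⟨le_triNorm_iff_lin.2 ?_, triNorm_le_iff_lin.2 ?_, by nlinarith, by nlinarith⟩
    · right; right; right; right; left; nlinarith
    · refine ⟨by nlinarith, by nlinarith, by nlinarith, by nlinarith, by nlinarith, by nlinarith⟩

/-! ### The straight sides and the vertices -/

/-- The side `x₀ = r` (from `(r, -r)` to `(r, 0)`): the tube `[r - e, r + e] × [-r - e, e]` crossed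
vertically. [folklore] -/
def side0 (r e : ℕ) : Tube := ⟨(r : ℤ) - e, -(r : ℤ) - e, 2 * e, r + 2 * e, false⟩

/-- The side `x₁ = r` (from `(0, r)` to `(-r, r)`): the tube `[-r - e, e] × [r - e, r + e]` crossed
horizontally. [folklore] -/
def side2 (r e : ℕ) : Tube := ⟨-(r : ℤ) - e, (r : ℤ) - e, r + 2 * e, 2 * e, true⟩

/-- At the vertex `(r, 0)`: the side `x₀ = r` crosses the first step `H_0` (`s ≤ r`). [folklore] -/
theorem crosses_side0_stairH_zero (r e s : ℕ) (hs : s ≤ r) : Crosses (side0 r e) (stairH r e s 0) := by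
  have hs' : (s : ℤ) ≤ r := by exact_mod_cast hs
  refine Or.inr ⟨rfl, rfl, ?_, ?_, ?_, ?_⟩ <;> simp only [side0, stairH] <;> push_cast <;> nlinarith

/-- At the vertex `(0, r)`: the last step `V_{n-1}` (`n s = r`) crosses the side `x₁ = r`. [folklore] -/
theorem crosses_stairV_last_side2 {r e s n : ℕ} (hn : n * s = r) (hn1 : 1 ≤ n) : Crosses (stairV r e s (n - 1)) (side2 r e) := by
  have h : ((n - 1 : ℕ) : ℤ) + 1 = n := by omega
  have hn' : (n : ℤ) * s = r := by exact_mod_cast hn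
  refine Or.inr ⟨rfl, rfl, ?_, ?_, ?_, ?_⟩ <;> simp only [side2, stairV] <;> push_cast <;> nlinarith [h, hn']

/-- At the vertex `(-r, r)`: the side `x₁ = r` crosses the side `x₀ = -r` (the reflection of the side
`x₀ = r`). [folklore] -/
theorem crosses_side2_neg_side0 (r e : ℕ) : Crosses (side2 r e) (side0 r e).neg := by
  refine Or.inl ⟨rfl, rfl, ?_, ?_, ?_, ?_⟩ <;> simp only [side2, side0, neg_a, neg_b, neg_w, neg_h] <;> push_cast <;> omega

/-- The side `x₀ = r` hugs the hexagon: norms in `[r - e, r + 2e]` (`2e ≤ r`). [folklore] -/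
theorem triNorm_mem_of_mem_side0 {r e : ℕ} (he : 2 * e ≤ r) {v : Site 2} (hv : v ∈ (side0 r e).box) :
    (r : ℤ) - e ≤ triNorm v ∧ triNorm v ≤ (r : ℤ) + 2 * e := by
  rw [Tube.mem_box] at hv; simp only [side0] at hv; push_cast at hv
  have he' : 2 * (e : ℤ) ≤ r := by exact_mod_cast he
  exact ⟨le_triNorm_iff_lin.2 (Or.inl (by omega)), triNorm_le_iff_lin.2 (by omega)⟩

/-- The side `x₁ = r` hugs the hexagon (`2e ≤ r`). [folklore] -/
theorem triNorm_mem_of_mem_side2 {r e : ℕ} (he : 2 * e ≤ r) {v : Site 2} (hv : v ∈ (side2 r e).box) :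
    (r : ℤ) - e ≤ triNorm v ∧ triNorm v ≤ (r : ℤ) + 2 * e := by
  rw [Tube.mem_box] at hv; simp only [side2] at hv; push_cast at hv
  have he' : 2 * (e : ℤ) ≤ r := by exact_mod_cast he
  exact ⟨le_triNorm_iff_lin.2 (Or.inr (Or.inr (Or.inl (by omega)))), triNorm_le_iff_lin.2 (by omega)⟩

/-! ### The half ring and the ring -/

/-- **Half the ring road**: the side `x₀ = r`, the staircase along `x₀ + x₁ = r` (`r / s` steps) and
the side `x₁ = r`, read counterclockwise. [cite: Nolin2008, §4.3 Prop. 12 (proof) (arXiv 0711.4948: Prop. 11)] -/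
def halfRing (r e s : ℕ) : List Tube := side0 r e :: stair r e s 0 (r / s) ++ [side2 r e]

/-- **The ring road around the hexagon `|v| = r`**: the half ring followed by its central
reflection (sides `x₀ = -r`, `x₀ + x₁ = -r`, `x₁ = -r`). [cite: Nolin2008, §4.3 Prop. 12 (proof) (arXiv 0711.4948: Prop. 11)] -/
def ring (r e s : ℕ) : List Tube := halfRing r e s ++ (halfRing r e s).map Tube.neg

/-- The half ring is a chain (`1 ≤ s`, `s ∣ r`, `s ≤ r`). [folklore] -/
theorem isChain_halfRing {r e s : ℕ} (hs : 1 ≤ s) (hsr : s ∣ r) (hr : s ≤ r) : List.IsChain Crosses (halfRing r e s) := by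
  have hn : (r / s) * s = r := Nat.div_mul_cancel hsr
  have hr' : 1 ≤ r / s := (Nat.le_div_iff_mul_le hs).2 (by simpa using hr)
  obtain ⟨d, hd⟩ : ∃ d, r / s = d + 1 := ⟨r / s - 1, by omega⟩
  unfold halfRing
  rw [List.cons_append]
  refine List.IsChain.cons ?_ ?_
  · refine List.IsChain.append (isChain_stair r e s 0 (r / s)) (List.isChain_singleton _) ?_
    intro x hx y hy
    rw [hd, getLast?_stair] at hx
    simp only [Option.mem_def, Option.some.injEq, List.head?_cons] at hx hy
    subst hx; subst hy
    have := crosses_stairV_last_side2 (e := e) hn hr'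
    rw [Nat.zero_add]
    rwa [hd, Nat.add_sub_cancel] at this
  · intro y hy
    rw [hd, List.head?_append, head?_stair, Option.some_or] at hy
    simp only [Option.mem_def, Option.some.injEq] at hy
    subst hy
    exact crosses_side0_stairH_zero r e s hr

/-- The half ring starts with the side `x₀ = r` and ends with the side `x₁ = r`. [folklore] -/
theorem head?_halfRing (r e s : ℕ) : (halfRing r e s).head? = some (side0 r e) := rfl

/-- The half ring ends with the side `x₁ = r`. [folklore] -/
theorem getLast?_halfRing (r e s : ℕ) : (halfRing r e s).getLast? = some (side2 r e) := by
  unfold halfRing; rw [List.getLast?_append]; simp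

/-- **The ring road is a chain of crossing tubes** (`1 ≤ s`, `s ∣ r`, `s ≤ r`). [cite: Nolin2008, §4.3 Prop. 12 (proof) (arXiv 0711.4948: Prop. 11)] -/
theorem isChain_ring {r e s : ℕ} (hs : 1 ≤ s) (hsr : s ∣ r) (hr : s ≤ r) : List.IsChain Crosses (ring r e s) := by
  unfold ring
  refine List.IsChain.append (isChain_halfRing hs hsr hr) (isChain_map_neg (isChain_halfRing hs hsr hr)) ?_
  intro x hx y hy
  rw [getLast?_halfRing] at hx
  rw [List.head?_map, head?_halfRing] at hy
  simp only [Option.mem_def, Option.some.injEq, Option.map_some] at hx hy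
  subst hx; subst hy
  exact crosses_side2_neg_side0 r e

/-- **The ring closes up**: its last tube (the side `x₁ = -r`) crosses its first tube (the side
`x₀ = r`) at the vertex `(r, -r)`. [folklore] -/
theorem crosses_ring_close (r e : ℕ) : Crosses (side2 r e).neg (side0 r e) := by
  refine Or.inl ⟨rfl, rfl, ?_, ?_, ?_, ?_⟩ <;> simp only [side2, side0, neg_a, neg_b, neg_w, neg_h] <;> push_cast <;> omega

/-- **The ring hugs the hexagon**: every site of a tube of the ring has norm in
`[r - s - 2e, r + 2e]` (`2e ≤ r`). [cite: Nolin2008, §4.3 Prop. 12 (proof) (arXiv 0711.4948: Prop. 11)] -/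
theorem triNorm_mem_of_mem_ring {r e s : ℕ} (he : 2 * e ≤ r) {T : Tube} (hT : T ∈ ring r e s) {v : Site 2} (hv : v ∈ T.box) :
    (r : ℤ) - s - 2 * e ≤ triNorm v ∧ triNorm v ≤ (r : ℤ) + 2 * e := by
  have hj : (0 + r / s) * s ≤ r := by rw [Nat.zero_add]; exact Nat.div_mul_le_self r s
  have half : ∀ T ∈ halfRing r e s, ∀ v ∈ T.box, (r : ℤ) - s - 2 * e ≤ triNorm v ∧ triNorm v ≤ (r : ℤ) + 2 * e := by
    intro T hT v hv
    unfold halfRing at hT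
    simp only [List.cons_append, List.mem_cons, List.mem_append, List.mem_nil_iff, or_false] at hT
    rcases hT with rfl | hT | rfl
    · have := triNorm_mem_of_mem_side0 he hv; exact ⟨by omega, this.2⟩
    · have := triNorm_mem_of_mem_stair hj hT hv; exact ⟨this.1, this.2.1⟩
    · have := triNorm_mem_of_mem_side2 he hv; exact ⟨by omega, this.2⟩
  unfold ring at hT
  rw [List.mem_append, List.mem_map] at hT
  rcases hT with hT | ⟨T', hT', rfl⟩
  · exact half T hT v hv
  · have := half T' hT' (-v) (mem_box_neg.1 hv)
    rwa [triNorm_neg] at this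

end Literature.Probability.Percolation
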